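import Summits.Ventures.QEC.Thresholds.OptimalDecoderThresholds
import Summits.Ventures.QEC.Thresholds.ToricCodeThresholdKernelSymmK16
import Summits.Ventures.QEC.Thresholds.ToricCodePhenomenologicalKernelZ3SymmK12
import Literature.InformationTheory.QuantumCodes.ToricCodeLatticeConverses
import HarnessLib

/-!
# The OPTIMAL accuracy threshold of the toric code (lattice DKLP objects): `.0357 < p_c^opt ≤ 1/4` (perfect
# measurement) and `.0112 < p_c^{ph,opt} ≤ 1/4` (noisy measurement, `q = p`) — DKLP's `p_c` with a certified interval

Venture QEC, `Summits/Ventures/QEC/Thresholds/` (LADDER-QEC rung Q5; qec-lit-2 gen 5). Companion of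
`OptimalDecoderThresholds.lean` (generic transfer lemmas; CSS families) for the DKLP objects of the tree:
`ToricCode.failureProb` / `toricFailureFamily D` (`ToricCodeThresholds.lean`) and `ToricCode.phenomFailureProb` /
`phenomFailureFamily T D` (`ToricCodePhenomenologicalThresholds.lean`).

Dennis–Kitaev–Landahl–Preskill 2002 define `p_c` (§4.3, §4.6) for the OPTIMAL recovery ("the optimal way to recover is
to guess that the homology class … is the class with the highest probability"; numerically `p_c = .1094 ± .0002`,
Honecker et al. — VALIDATED column) and bound it from below via minimum-weight recovery (§4.7: "the critical value of `p`
at zero temperature provides a lower bound on `p_c`"; §5.3). Here: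

* `toricOptimalFailureFamily` / `toricOptimalPhenomFailureFamily T`: rate by rate the least failure probability over ALL
  (space-time) decoders (`Decoder.optimalFailureMass`, attained by maximum-likelihood decoding; `≤` every decoder family,
  `toricOptimalFailureFamily_le`);
* **DKLP §4.7 as a theorem**: `accuracyThreshold (toricFailureFamily D) ≤ accuracyThreshold toricOptimalFailureFamily` for
  EVERY decoder family `D` (`toric_accuracyThreshold_le_optimal`; phenomenological twin);
* **`0.0357 < p_c^opt ≤ 1/4`** (`toric_optimal_accuracyThreshold_mem`): floor = the kernel Pönitz–Tittmann `μ(ℤ²) ≤ 2.6939`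
  bound for minimum-weight decoding (`ToricCode.accuracyThreshold_minWeight_gt_0357`), ceiling = erasure decomposition +
  no-cloning for EVERY decoder (`ToricCode.quarter_le_failureProb_quarter`); with `T_L` noisy rounds (`T` polynomially
  bounded, `T_L ≥ 1`) **`0.0112 < p_c^{ph,opt} ≤ 1/4`** (`toric_phenom_optimal_accuracyThreshold_mem`);
* **monotonicity**: the optimal family is non-decreasing on `[0, 1/2]` (degradation of the bit-flip family), so its
  below-threshold rates form an initial segment and every below-threshold `p' ≤ 1/2` is `≤ p_c`
  (`toric_optimal_le_accuracyThreshold_of_belowThreshold`) — `p_c` is a threshold in the strict sense.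

HONEST FRAMING: theorem-only (plus two definitions of families); kernel axioms; no named fact; no `native_decide`; the
printed `.1094` and `.029–.033` are numerics, not theorems; the interval is what is certified.

## References

* [DennisEtAl2002] E. Dennis, A. Kitaev, A. Landahl, J. Preskill, J. Math. Phys. 43 (2002) 4452, §4.3 eq. (prob_homol);
  §4.6 (`p_c = .1094 ± .0002`); §4.7; §5.3 eqs. (p_c_2d), (threshold_iso_num).
* [BravyiSucharaVargo2014] S. Bravyi, M. Suchara, A. Vargo, Phys. Rev. A 90 (2014) 032326, §1–§2 (MLD is optimal).
* [RichardsonUrbanke2008] T. Richardson, R. Urbanke, *Modern Coding Theory*, Lemma 4.78 (erasure decomposition),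
  Example 4.71 (degradation of {BSC(ε)}).
* [PonitzTittmann2000] A. Pönitz, P. Tittmann, Discrete Appl. Math. 104 (2000) 281, Table 2 (`μ(ℤ²) ≤ 2.6939`, `μ(ℤ³) ≤ 4.7476`).
-/

noncomputable section

namespace Summit.Ventures.QEC.Thresholds

open Filter Topology Finset Matrix
open Literature.InformationTheory.QuantumCodes
open Literature.InformationTheory.QuantumCodes.ToricCode

/-! ### The toric code (lattice DKLP objects): the optimal code-capacity and phenomenological families -/

section Toric

/-- **The optimal toric failure family**: for the `(L+1) × (L+1)` toric code and rate `p`, the least failure probability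
over ALL decoders under independent `Z`-errors of rate `p` with perfect syndrome measurement — DKLP's `p_c` is the
accuracy threshold of THIS family. [cite: DennisEtAl2002, §4.3 (the optimal way to recover) and §4.6 (p_c)] -/
def toricOptimalFailureFamily : ℕ → ℝ → ℝ :=
  fun L p => Decoder.optimalFailureMass (fun e : Chain (L + 1) => bernoulliWeight p (supp e)) (syn (L + 1))
    (boundaries (L + 1))

open Classical in
/-- The DKLP failure probability of a decoder is the abstract failure mass (definitional bridge).
[cite: DennisEtAl2002, §5.2 (Prob_fail)] -/
theorem failureProb_eq_failureMass (L : ℕ) [NeZero L] (D : ZDecoder L) (p : ℝ) :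
    failureProb L D p = Decoder.failureMass (fun e : Chain L => bernoulliWeight p (supp e)) (syn L) (boundaries L) D :=
  rfl

/-- **No decoder family beats the optimal toric family** (pointwise).
[cite: BravyiSucharaVargo2014, §1 (MLD is the optimal error correction algorithm)] -/
theorem toricOptimalFailureFamily_le (D : (L : ℕ) → ZDecoder (L + 1)) (L : ℕ) (p : ℝ) :
    toricOptimalFailureFamily L p ≤ toricFailureFamily D L p := by
  rw [toricFailureFamily, failureProb_eq_failureMass]
  exact Decoder.optimalFailureMass_le _ _ _ (D L)

/-- The optimal toric family is attained by (maximum-likelihood) decoders, size by size and rate by rate.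
[cite: BravyiSucharaVargo2014, §2 (ML Decoder)] -/
theorem exists_toricFailureFamily_eq_optimal (L : ℕ) (p : ℝ) :
    ∃ D : ZDecoder (L + 1), failureProb (L + 1) D p = toricOptimalFailureFamily L p := by
  obtain ⟨D, _, hD⟩ := Decoder.exists_failureMass_eq_optimal (fun e : Chain (L + 1) => bernoulliWeight p (supp e))
    (syn (L + 1)) (boundaries (L + 1))
  exact ⟨D, by rw [failureProb_eq_failureMass]; exact hD⟩

/-- `0 ≤` the optimal toric family on `[0, 1]`. [cite: DennisEtAl2002, §4.3 eq. (ec_cond)] -/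
theorem toricOptimalFailureFamily_nonneg (L : ℕ) {p : ℝ} (hp0 : 0 ≤ p) (hp1 : p ≤ 1) :
    0 ≤ toricOptimalFailureFamily L p :=
  Decoder.optimalFailureMass_nonneg _ _ fun e => bernoulliWeight_nonneg hp0 hp1 (supp e)

/-- **DKLP §4.7 as a theorem for the toric code**: the accuracy threshold of ANY decoder family (in particular every
minimum-weight = matching decoder family) is at most the optimal accuracy threshold `p_c`.
[cite: DennisEtAl2002, §4.7 (the critical value at zero temperature provides a lower bound on p_c)] -/
theorem toric_accuracyThreshold_le_optimal (D : (L : ℕ) → ZDecoder (L + 1)) :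
    accuracyThreshold (toricFailureFamily D) ≤ accuracyThreshold toricOptimalFailureFamily :=
  accuracyThreshold_le_of_le (fun L _ hp0 hp1 => toricOptimalFailureFamily_nonneg L hp0 hp1)
    fun L p _ _ => toricOptimalFailureFamily_le D L p

/-- **`p_c > .0357` for the OPTIMAL decoder** (toric code, perfect measurement) — from the kernel-certified
minimum-weight floor (Pönitz–Tittmann `μ(ℤ²) ≤ 2.6939`). UNCONDITIONAL, kernel.
[cite: DennisEtAl2002, §4.7 and §5.3 eq. (p_c_2d)] -/
theorem toric_optimal_accuracyThreshold_gt_0357 : (0.0357 : ℝ) < accuracyThreshold toricOptimalFailureFamily :=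
  lt_of_lt_of_le ToricCode.accuracyThreshold_minWeight_gt_0357 (toric_accuracyThreshold_le_optimal _)

/-- **`p_c ≤ 1/4` for the OPTIMAL decoder** (toric code, perfect measurement): at rate `1/4` even maximum-likelihood
decoding fails with probability `≥ 1/4`. [cite: RichardsonUrbanke2008, Lemma 4.78; DennisEtAl2002, §4.6 (p_c)] -/
theorem toric_optimal_threshold_le_quarter {a : ℝ} (ha : IsThresholdLowerBound toricOptimalFailureFamily a) :
    a ≤ 1 / 4 := by
  by_contra h
  push Not at h
  refine not_belowThreshold_of_le (c := 1 / 4) (by norm_num) (fun L => ?_) (ha (1 / 4) (by norm_num) h)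
  obtain ⟨D, hD⟩ := exists_toricFailureFamily_eq_optimal L (1 / 4)
  rw [← hD]
  exact quarter_le_failureProb_quarter D

/-- **THE OPTIMAL TORIC THRESHOLD INTERVAL `.0357 < p_c ≤ 1/4`** (DKLP's `p_c` of §4.6, whose numerical value is
`.1094 ± .0002` — VALIDATED, not a theorem): certified floor via minimum-weight decoding, certified ceiling for every
decoder. UNCONDITIONAL, kernel. [cite: DennisEtAl2002, §4.6 (p_c) and §4.7; RichardsonUrbanke2008, Lemma 4.78] -/
theorem toric_optimal_accuracyThreshold_mem :
    (0.0357 : ℝ) < accuracyThreshold toricOptimalFailureFamily ∧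
      accuracyThreshold toricOptimalFailureFamily ≤ 1 / 4 :=
  ⟨toric_optimal_accuracyThreshold_gt_0357,
    toric_optimal_threshold_le_quarter (isThresholdLowerBound_accuracyThreshold _)⟩

/-- **The optimal toric family is non-decreasing in the rate on `[0, 1/2]`** (degradation of the bit-flip family;
the boundary map `∂ = H^X` is additive). [cite: RichardsonUrbanke2008, Example 4.71; DennisEtAl2002, §4.7] -/
theorem toricOptimalFailureFamily_mono (L : ℕ) {p p' : ℝ} (hpp' : p ≤ p') (hp' : p' ≤ 1 / 2) :
    toricOptimalFailureFamily L p ≤ toricOptimalFailureFamily L p' :=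
  Decoder.optimalFailureMass_flip_mono (fun a b => by simp [syn, Matrix.mulVec_add]) _ hpp' hp'

/-- **Below-threshold rates of the optimal toric decoder form an initial segment of `[0, 1/2]`.**
[cite: DennisEtAl2002, §4.3 (below threshold) with RichardsonUrbanke2008, Example 4.71] -/
theorem toric_optimal_belowThreshold_of_le {p p' : ℝ} (h : BelowThreshold toricOptimalFailureFamily p')
    (hp0 : 0 ≤ p) (hpp' : p ≤ p') (hp' : p' ≤ 1 / 2) : BelowThreshold toricOptimalFailureFamily p := by
  unfold BelowThreshold at h ⊢
  exact squeeze_zero (fun L => toricOptimalFailureFamily_nonneg L hp0 (by linarith))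
    (fun L => toricOptimalFailureFamily_mono L hpp' hp') h

/-- **DKLP's `p_c` is a threshold in the strict sense**: every below-threshold rate `p' ≤ 1/2` of the optimal toric
family is `≤ accuracyThreshold toricOptimalFailureFamily` (and every `0 ≤ p < accuracyThreshold` is below threshold,
`belowThreshold_of_lt_accuracyThreshold`). [cite: DennisEtAl2002, §4.3 and §4.6 (p_c)] -/
theorem toric_optimal_le_accuracyThreshold_of_belowThreshold {p' : ℝ} (hp' : p' ≤ 1 / 2)
    (h : BelowThreshold toricOptimalFailureFamily p') : p' ≤ accuracyThreshold toricOptimalFailureFamily :=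
  le_accuracyThreshold (fun p hp0 hpp' => toric_optimal_belowThreshold_of_le h hp0 hpp'.le hp') (by linarith)

/-! #### Noisy syndrome measurement (`q = p`, `T_L` rounds) -/

variable {T : ℕ → ℕ}

/-- **The optimal phenomenological toric family**: for `T L` noisy rounds on the `(L+1) × (L+1)` toric code at
isotropic rates `q = p`, the least failure probability over ALL space-time decoders.
[cite: DennisEtAl2002, §4.3 (optimal recovery of the error history) and §5.3 (p = q)] -/
def toricOptimalPhenomFailureFamily (T : ℕ → ℕ) : ℕ → ℝ → ℝ :=
  fun L p => Decoder.optimalFailureMass (fun E : History (L + 1) (T L) => phenomenologicalWeight (T L) p p (supp E))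
    (stSyn (L + 1) (T L)) (stTrivial (L + 1) (T L))

open Classical in
/-- The DKLP space-time failure probability is the abstract failure mass (definitional bridge).
[cite: DennisEtAl2002, §5.2 (Prob_fail)] -/
theorem phenomFailureProb_eq_failureMass (L Tr : ℕ) [NeZero L] (D : STDecoder L Tr) (p q : ℝ) :
    phenomFailureProb L Tr D p q =
      Decoder.failureMass (fun E : History L Tr => phenomenologicalWeight Tr p q (supp E)) (stSyn L Tr)
        (stTrivial L Tr) D :=
  rfl

/-- **No space-time decoder family beats the optimal phenomenological family** (pointwise).
[cite: BravyiSucharaVargo2014, §1 (MLD is the optimal error correction algorithm)] -/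
theorem toricOptimalPhenomFailureFamily_le (D : (L : ℕ) → STDecoder (L + 1) (T L)) (L : ℕ) (p : ℝ) :
    toricOptimalPhenomFailureFamily T L p ≤ phenomFailureFamily T D L p := by
  rw [phenomFailureFamily, phenomFailureProb_eq_failureMass]
  exact Decoder.optimalFailureMass_le _ _ _ (D L)

/-- The optimal phenomenological family is attained by (maximum-likelihood) space-time decoders.
[cite: BravyiSucharaVargo2014, §2 (ML Decoder)] -/
theorem exists_phenomFailureFamily_eq_optimal (L : ℕ) (p : ℝ) :
    ∃ D : STDecoder (L + 1) (T L), phenomFailureProb (L + 1) (T L) D p p = toricOptimalPhenomFailureFamily T L p := by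
  obtain ⟨D, _, hD⟩ := Decoder.exists_failureMass_eq_optimal
    (fun E : History (L + 1) (T L) => phenomenologicalWeight (T L) p p (supp E)) (stSyn (L + 1) (T L))
    (stTrivial (L + 1) (T L))
  exact ⟨D, by rw [phenomFailureProb_eq_failureMass]; exact hD⟩

/-- The phenomenological weight is non-negative for rates in `[0, 1]`. [cite: DennisEtAl2002, §5.1 eq. (HV_prob)] -/
theorem phenomenologicalWeight_nonneg' {Q C : Type*} [Fintype Q] [Fintype C] [DecidableEq Q] [DecidableEq C]
    (Tr : ℕ) {p q : ℝ} (hp0 : 0 ≤ p) (hp1 : p ≤ 1) (hq0 : 0 ≤ q) (hq1 : q ≤ 1) (E : Finset (HistoryLoc Q C Tr)) :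
    0 ≤ phenomenologicalWeight Tr p q E := by
  unfold phenomenologicalWeight
  refine indepWeight_nonneg (fun i => ?_) (fun i => ?_) E
  · cases i <;> simp [phenomRate, hp0, hq0]
  · cases i <;> simp [phenomRate, hp1, hq1]

/-- `0 ≤` the optimal phenomenological family on `[0, 1]`. [cite: DennisEtAl2002, §5.2 (Prob_fail)] -/
theorem toricOptimalPhenomFailureFamily_nonneg (L : ℕ) {p : ℝ} (hp0 : 0 ≤ p) (hp1 : p ≤ 1) :
    0 ≤ toricOptimalPhenomFailureFamily T L p :=
  Decoder.optimalFailureMass_nonneg _ _ fun E => phenomenologicalWeight_nonneg' (T L) hp0 hp1 hp0 hp1 (supp E)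

/-- **DKLP §4.7, phenomenological form**: the accuracy threshold of ANY space-time decoder family is at most the
optimal one. [cite: DennisEtAl2002, §4.7 (a lower bound on p_c) and §5.3 (p = q)] -/
theorem toric_phenom_accuracyThreshold_le_optimal (D : (L : ℕ) → STDecoder (L + 1) (T L)) :
    accuracyThreshold (phenomFailureFamily T D) ≤ accuracyThreshold (toricOptimalPhenomFailureFamily T) :=
  accuracyThreshold_le_of_le (fun L _ hp0 hp1 => toricOptimalPhenomFailureFamily_nonneg L hp0 hp1)
    fun L p _ _ => toricOptimalPhenomFailureFamily_le D L p

/-- **`p_c^{ph} > .0112` for the OPTIMAL space-time decoder** (every polynomially bounded round schedule) — from the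
kernel-certified minimum-weight floor (`μ(ℤ³) ≤ 4.7476`). UNCONDITIONAL, kernel.
[cite: DennisEtAl2002, §5.3 eq. (threshold_iso_num); PonitzTittmann2000, Table 2] -/
theorem toric_phenom_optimal_accuracyThreshold_gt_0112 (hT : IsPolyBounded T) :
    (0.0112 : ℝ) < accuracyThreshold (toricOptimalPhenomFailureFamily T) :=
  lt_of_lt_of_le
    (phenom_accuracyThreshold_gt_0112 hT fun L => ToricCode.isMinWeight_stMinWeight (L + 1) (T L))
    (toric_phenom_accuracyThreshold_le_optimal _)

/-- **`p_c^{ph} ≤ 1/4` for the OPTIMAL space-time decoder** (every schedule with `T_L ≥ 1` rounds).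
[cite: RichardsonUrbanke2008, Lemma 4.78; DennisEtAl2002, §4.6 and §5.3] -/
theorem toric_phenom_optimal_threshold_le_quarter (hT : ∀ L, 0 < T L) {a : ℝ}
    (ha : IsThresholdLowerBound (toricOptimalPhenomFailureFamily T) a) : a ≤ 1 / 4 := by
  by_contra h
  push Not at h
  refine not_belowThreshold_of_le (c := 1 / 4) (by norm_num) (fun L => ?_) (ha (1 / 4) (by norm_num) h)
  obtain ⟨D, hD⟩ := exists_phenomFailureFamily_eq_optimal (T := T) L (1 / 4)
  rw [← hD]
  exact quarter_le_phenomFailureProb_quarter D ⟨0, hT L⟩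

/-- **THE OPTIMAL PHENOMENOLOGICAL TORIC THRESHOLD INTERVAL `.0112 < p_c^{ph} ≤ 1/4`** (every polynomially bounded
schedule with `T_L ≥ 1`; DKLP's printed estimate for minimum-weight decoding is `.0114`, numerics `≈ .03` —
VALIDATED). UNCONDITIONAL, kernel. [cite: DennisEtAl2002, §5.3 eq. (threshold_iso_num) and §4.6; RichardsonUrbanke2008, Lemma 4.78] -/
theorem toric_phenom_optimal_accuracyThreshold_mem (hT : IsPolyBounded T) (hT1 : ∀ L, 0 < T L) :
    (0.0112 : ℝ) < accuracyThreshold (toricOptimalPhenomFailureFamily T) ∧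
      accuracyThreshold (toricOptimalPhenomFailureFamily T) ≤ 1 / 4 :=
  ⟨toric_phenom_optimal_accuracyThreshold_gt_0112 hT,
    toric_phenom_optimal_threshold_le_quarter hT1 (isThresholdLowerBound_accuracyThreshold _)⟩

/-- The canonical schedule `T(L) = L + 1`: `.0112 < p_c^{ph,opt} ≤ 1/4`. [cite: DennisEtAl2002, §5.2 ¶1 (T = O(L)) and §5.3] -/
theorem toric_phenom_optimal_accuracyThreshold_mem_succ :
    (0.0112 : ℝ) < accuracyThreshold (toricOptimalPhenomFailureFamily fun L => L + 1) ∧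
      accuracyThreshold (toricOptimalPhenomFailureFamily fun L => L + 1) ≤ 1 / 4 :=
  toric_phenom_optimal_accuracyThreshold_mem isPolyBounded_succ fun L => Nat.succ_pos L

end Toric

end Summit.Ventures.QEC.Thresholds
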